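import Literature.MathematicalPhysics.QuantumFieldTheory.Balaban1983to89.B8Prop3GaugeFixedKLevel
import Literature.MathematicalPhysics.QuantumFieldTheory.Balaban1983to89.B8Eq138LandauZd
import Literature.MathematicalPhysics.QuantumFieldTheory.Balaban1983to89.B8Thm4ExistsModB9

/-!
# `Balaban1983to89.B8Thm4AtLandau138` — [Balaban1985RegularSpaces] THEOREM 4 (p. 88), EXISTENCE CLAUSE AT ALL LEVELS ON THE CONCRETE
# `ℤᵈ × 𝔸` CARRIERS, WITH THE LANDAU EQUATION (1.38) INSTANTIATED: the knit `B8Prop3GaugeFixedKLevel.thm4_exists_all_levels_of_b9`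
# (driver `B8Thm4InductionLocal.thm4_exists_all_levels` + Proposition 3 for gauge-fixed fields) at
# `Lan m W := B8Eq138LandauZd.IsLandau138W L m η (Ω 0) (Λs m) U₀ W` — the multiplier form of «R(U₀)D^{η*}_{U₀}A = 0»

statement-level skeleton of published theorems with citation tags; proofs where landed; nothing here is a claim about the
Yang–Mills mass gap

PDF held: `paper:balaban1985-cmp99-regular-spaces-gauge-fixing` (journal page = PDF page + 74); pp. 82, 88, 92–95.

WHY THIS FILE (cell `pub-ymgap`, seat `pub-ymgap-dag-n05-a` g4, the KNIT seat of DAG node N05 = [B8]).  Until now every Theorem-4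
sentence on the concrete carriers carried the Landau equation (1.38) as an ARBITRARY level-indexed predicate `Lan` (no object `R(U₀)`
on these carriers — I-B8-2).  `B8Eq138LandauZd` defines (1.38) there in Lagrange-multiplier form (`IsLandau138W`; justified by
`B8Eq138Multiplier`: «R f = 0 ⟺ ∃ μ, Δ f = Q′\* μ» from the (3.25)-inverse laws of [4] alone), so the knitted existence clause can now
be stated with NO free predicate: this file is that specialisation — a kernel check that the instance fits the socket shapes
verbatim, and the place where the REMAINING HYPOTHESES of Theorem 4's existence clause on these carriers become fully concrete
sentences for the -b programme / the NODE 00 pin: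
* `hP5base` / `hP5 m` = PROPOSITION 5 (existence, (1.107)–(1.108)) at `1` / `m + 1` levels for the base / level-`m` datum, its Landau
  clause now reading `IsLandau138W L (m+1) η (Ω 0) (Λs (m+1)) U₀ (U₁^{v⁻¹})` — by `B8Eq195Linear.fixedPoint_iff_constraint_and_multiplier`
  a provider obtains it from a fixed point of (1.100) with the letters G′, (Q′G′²Q′ᵀ)^{−1} of [4] as hypotheses (in-edge b9);
* `H59` = [4] Theorem 3.3 for G(U₀) ((1.59)) per gauge-fixed `(u, W, A′)`, guarded by `IsLandau138W L m …` (in-edge b9);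
* `H42` = the (1.42) clause per `(u, W, A′)` (B8-internal, `pub-ymgap-dag-n04-b` Stage 2);
* (1.33)/(1.34) `h33`/`h34`, (1.66)₀ `h66`, the explicit smallness windows (the pin schedules them).

WHAT THIS FILE PROVES (kernel, 0 sorry, theorems only): **`thm4_exists_all_levels_landau138`** = `thm4_exists_all_levels_of_b9` at
`Lan := fun m W => IsLandau138W L m η (Ω 0) (Λs m) U₀ W`; **`thm4_unique_of_agree_landau138`** = `B8Thm4UniqueLocal.thm4_unique_of_agree`
at `Lan := IsLandau138W L k η Ω₀ Λ U₀`; **`thm4_exists_leafShape_landau138`** — the top level `k` in the LEAF'S SHAPE «∃ u restricted,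
`U₁ = U′^{u⁻¹}` satisfies (1.38) and `U₁ = e^{iηA}`, `A = (iη)⁻¹ log U₁` self-adjoint with (1.62) on the bonds of `Ω_j`» (the `∃ W` of the
driver resolved by `eq_mgauge_inv_of_mgauge_eq`, the exponent read back by `logField_spec`); `isLandau138W_datum_congr` — the Landau clause of the conclusion depends on
`W = U′^{u⁻¹}` only through Ω₀'s bonds (`B8Eq138LandauZd.isLandau138W_congr`; the hazard №3′ law, now a property of the instance).

HONEST SCOPE.  Two specialisations; nothing of Proposition 5, of [4]'s Theorems 3.3/3.11 or of (1.42) is proved here.  Count-neutral; N05 NOT discharged; nothing continuum / ℝ⁴ / OS / mass-gap / Clay.  Unit `pub-ymgap-dag-n05-a` (g4), 2026-08-26.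
-/

noncomputable section

namespace Literature.MathematicalPhysics.QuantumFieldTheory.Balaban1983to89.B8Thm4AtLandau138

open MatrixLog B7Prop1Explicit B7Prop2Explicit B7Prop1Local B7Eq92Concrete
open B8Lemma1NonAbelian (mulCfg)
open B8Ineq132 (covDerivFwd InAk BondTouches)
open B8Eq140Level (SideTouches sideTouches_of_bondTouches)
open B8Eq184Proof (gaugeExp cfgExp)
open B8Eq146AExpansion (iEta)
open B7Prop4GeneralLevels (logCovIter linCovIter)
open B8Eq155JBound (Jcur wsup)
open B8ScaledSupNorm (bondNorm msup)
open B7Prop3Flat (c3)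
open B8Eq138LandauZd (IsLandau138W isLandau138W_congr logCfg)
open B8Prop3GaugeFixedKLevel (thm4_exists_all_levels_of_b9 eq_mgauge_inv_of_mgauge_eq mem_unitaryUnits_of_mgauge_eq logField_spec)
open B8Thm4UniqueLocal (thm4_unique_of_agree)
open B8Ineq130 (tlo thi)
open B8Eq119TwistedAxial (Restr129 InAx)

-- `Site` alone could resolve to the torus sites of `Setup.lean`; re-export the `ℤ^d` sites of `B7Prop1Explicit`.
export B7Prop1Explicit (Site)

variable {d : ℕ}

section Main

variable {𝔸 : Type*} [CStarAlgebra 𝔸] [Nontrivial 𝔸]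

omit [Nontrivial 𝔸] in
/-- **The Landau clause of the instance depends on the gauge-fixed field only through Ω₀'s bonds** (hazard №3′ law of the knit, now a
property of `IsLandau138W`): two configurations agreeing on the sides of the plaquettes touching `Ω 0` (`d ≥ 2`: every bond with an
endpoint in `Ω 0` is such a side, `B8Eq140Level.sideTouches_of_bondTouches`) satisfy (1.38) together.
[cite: Balaban1985RegularSpaces, (1.38) p.82, p.77] -/
theorem isLandau138W_datum_congr (hd2 : 2 ≤ d) (L m : ℕ) (η : ℝ) (Ω : ℕ → Set (Site d)) (Λs : ℕ → ℕ → Set (Site d))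
    (U₀ : Site d → Fin d → 𝔸ˣ) {W W' : Site d → Fin d → 𝔸ˣ}
    (h : ∀ (x : Site d) (μ : Fin d), SideTouches (Ω 0) x μ → W x μ = W' x μ) :
    IsLandau138W L m η (Ω 0) (Λs m) U₀ W ↔ IsLandau138W L m η (Ω 0) (Λs m) U₀ W' := by
  haveI : Nontrivial (Fin d) := Fin.nontrivial_iff_two_le.mpr hd2
  refine isLandau138W_congr η L U₀ fun x μ hb => h x μ ?_
  obtain ⟨κ, hκ⟩ := exists_ne μ
  exact sideTouches_of_bondTouches hκ hb

/-- **THEOREM 4, EXISTENCE CLAUSE AT ALL LEVELS, ON THE CONCRETE `ℤᵈ × 𝔸` CARRIERS, LANDAU EQUATION INSTANTIATED** — the knit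
`B8Prop3GaugeFixedKLevel.thm4_exists_all_levels_of_b9` (induction driver `B8Thm4InductionLocal.thm4_exists_all_levels` with Proposition 3
for gauge-fixed fields serving its socket `hP3`) at `Lan m W := IsLandau138W L m η (Ω 0) (Λs m) U₀ W`, the multiplier form of (1.38)
«R(U₀)D^{η*}_{U₀}A = 0» for `A = (iη)⁻¹ log W` with `m` averaging levels (`B8Eq138LandauZd`).  CONCLUSION: for every `m ≤ k` a
unitary-valued `u` with (1.29) at `m` levels whose `W = U′^{u⁻¹}` satisfies (1.38) (for `m ≥ 1`) and `W_b = e^{iηA_b}`, `A_b`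
self-adjoint, `‖A_b‖ ≤ c⋆(Lʲη)⁻¹` on the bonds of `Ω_j`, `j ≤ m` (`c⋆ = 5dLB₀(α₀ + α₁)`), MODULO: Proposition 5 at levels `1` / `m + 1`
for the data the induction produces (`hP5base`, `hP5`), [4] Theorem 3.3 for `G(U₀)` per gauge-fixed field (`H59`, in-edge b9), the
(1.42) clause per gauge-fixed field (`H42`), and the standing hypotheses (1.33)/(1.34)/(1.66)₀ + explicit smallness windows.
[cite: Balaban1985RegularSpaces, Thm 4 p.88, (1.38) p.82, Prop. 3 p.87, Prop. 5 p.94, pp.94–95] -/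
theorem thm4_exists_all_levels_landau138 (hd2 : 2 ≤ d) {η : ℝ} (hη : 0 < η) {L : ℕ} (hL : 2 ≤ L) (k : ℕ)
    {U₀ U' : Site d → Fin d → 𝔸ˣ} (hU₀ : ∀ x κ, U₀ x κ ∈ unitaryUnits 𝔸) (hU' : ∀ x κ, U' x κ ∈ unitaryUnits 𝔸)
    {α₀ α₁ α₄ B₀ cstar a : ℝ} (hα₀ : 0 < α₀) (hα₁ : 0 ≤ α₁) (hα₄ : 0 ≤ α₄) (hB₀ : 0 ≤ B₀)
    (hc : cstar = 5 * d * L * B₀ * (α₀ + α₁))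
    (hs₁ : α₄ ≤ 1 / 84) (hs₂ : L * cstar ≤ 1 / 12) (ha : a ≤ 1 / 4) (ha2 : 2 * a ≤ cstar)
    (hα3 : C0 d * α₀ ≤ 1 / 3) (hα4 : 4 * α₀ ≤ c2' d L)
    (h16 : 16 * (2 * (L * cstar) + 8 * α₄) ≤ 1) (hd5 : 5 * (2 * (L * cstar) + 8 * α₄) * ((d : ℝ) - 1) ≤ 4)
    (hsmall : Real.exp (4 * (800 * ((d : ℝ) + 1) ^ 2 * ((d : ℝ) + 4)) * α₀)
      * (1 + 8 * (131072 * ((d : ℝ) + 1) ^ 2) * (2 * (L * cstar) + 8 * α₄)) ≤ 2)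
    (hc₃ : 2 * (2 * (L * cstar) + 8 * α₄) ≤ c3 d L) (hside : 36 * d * B₀ * (2 * (L * cstar) + 8 * α₄) ≤ 1 / 2)
    (h50 : 50 * d * (2 * (L * cstar) + 8 * α₄) ≤ 1)
    {C₂ : ℝ} (hC₂ : 8 * (131072 * ((d : ℝ) + 1) ^ 2) * Real.exp (4 * (800 * ((d : ℝ) + 1) ^ 2 * ((d : ℝ) + 4)) * α₀) ≤ C₂)
    (h61 : 2 * (2 * (L * cstar) + 8 * α₄) ^ 2 + 20 * d * α₀ * (2 * (L * cstar) + 8 * α₄)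
      + 2 * C₂ * (2 * (L * cstar) + 8 * α₄) ^ 2 ≤ α₀ + α₁)
    (Ω : ℕ → Set (Site d)) (hΩ : ∀ j, Ω (j + 1) ⊆ Ω j) (Λs : ℕ → ℕ → Set (Site d)) (Λb : ℕ → ℕ → Set (Site d × Fin d))
    (hbox : ∀ m, m ≤ k → ∀ j, j ≤ m → ∀ c ∈ Λb m j, ∀ x, InBox (loK L j c.1) (bondHiK L j c.1 c.2) x → x ∈ Ω j)
    (h33 : InAk L k η α₀ Ω U₀) (h34 : InAk L k η α₀ Ω (mulCfg U' U₀))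
    (h66 : ∀ b ∈ {b : Site d × Fin d | SideTouches (Ω 0) b.1 b.2}, ‖((U' b.1 b.2 : 𝔸ˣ) : 𝔸) - 1‖ ≤ a)
    (hP5base : ∃ (v : Site d → 𝔸ˣ) (lam : Site d → 𝔸), (∀ x, v x ∈ unitaryUnits 𝔸) ∧
        (∀ j, j ≤ 1 → ∀ b ∈ {b : Site d × Fin d | SideTouches (Ω j) b.1 b.2}, (v b.1 : 𝔸) = ((gaugeExp lam b.1 : 𝔸ˣ) : 𝔸) ∧
          (v (b.1 + e b.2) : 𝔸) = ((gaugeExp lam (b.1 + e b.2) : 𝔸ˣ) : 𝔸)) ∧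
        (∀ j, j ≤ 1 → ∀ b ∈ {b : Site d × Fin d | SideTouches (Ω j) b.1 b.2},
          ‖lam b.1‖ ≤ α₄ ∧ ((L : ℝ) ^ j * η) * ‖covDerivFwd η U₀ b.2 lam b.1‖ ≤ α₄) ∧
        IsLandau138W L 1 η (Ω 0) (Λs 1) U₀ (mgauge U₀ v⁻¹ U') ∧ Restr129 L 1 (Λs 1) U₀ ((1 : Site d → 𝔸ˣ) * v))
    (hP5 : ∀ m, 1 ≤ m → m < k → ∀ (u₁ : Site d → 𝔸ˣ) (U₁ : Site d → Fin d → 𝔸ˣ) (A : Site d → Fin d → 𝔸),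
      (∀ x, u₁ x ∈ unitaryUnits 𝔸) → mgauge U₀ u₁ U₁ = U' → Restr129 L m (Λs m) U₀ u₁ → IsLandau138W L m η (Ω 0) (Λs m) U₀ U₁ →
      (∀ j, j ≤ m → ∀ b ∈ {b : Site d × Fin d | SideTouches (Ω j) b.1 b.2},
        U₁ b.1 b.2 = cfgExp η A b.1 b.2 ∧ IsSelfAdjoint (A b.1 b.2) ∧ ‖A b.1 b.2‖ ≤ cstar * ((L : ℝ) ^ j * η)⁻¹) →
      ∃ (v : Site d → 𝔸ˣ) (lam : Site d → 𝔸), (∀ x, v x ∈ unitaryUnits 𝔸) ∧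
        (∀ j, j ≤ m + 1 → ∀ b ∈ {b : Site d × Fin d | SideTouches (Ω j) b.1 b.2}, (v b.1 : 𝔸) = ((gaugeExp lam b.1 : 𝔸ˣ) : 𝔸) ∧
          (v (b.1 + e b.2) : 𝔸) = ((gaugeExp lam (b.1 + e b.2) : 𝔸ˣ) : 𝔸)) ∧
        (∀ j, j ≤ m + 1 → ∀ b ∈ {b : Site d × Fin d | SideTouches (Ω j) b.1 b.2},
          ‖lam b.1‖ ≤ α₄ ∧ ((L : ℝ) ^ j * η) * ‖covDerivFwd η U₀ b.2 lam b.1‖ ≤ α₄) ∧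
        IsLandau138W L (m + 1) η (Ω 0) (Λs (m + 1)) U₀ (mgauge U₀ v⁻¹ U₁) ∧ Restr129 L (m + 1) (Λs (m + 1)) U₀ (u₁ * v))
    (H42 : ∀ m, 1 ≤ m → m ≤ k → ∀ (u : Site d → 𝔸ˣ) (W : Site d → Fin d → 𝔸ˣ) (A' : Site d → Fin d → 𝔸),
      (∀ x, u x ∈ unitaryUnits 𝔸) → mgauge U₀ u W = U' → Restr129 L m (Λs m) U₀ u → IsLandau138W L m η (Ω 0) (Λs m) U₀ W →
      (∀ y τ, IsSelfAdjoint (A' y τ)) →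
      (∀ j, j ≤ m → ∀ y τ, SideTouches (Ω j) y τ →
        W y τ = cfgExp η A' y τ ∧ ‖A' y τ‖ ≤ (2 * (L * cstar) + 8 * α₄) * ((L : ℝ) ^ j * η)⁻¹) →
      (∀ y τ, (∀ j, j ≤ m → ¬ SideTouches (Ω j) y τ) → A' y τ = 0) →
      ∀ j, j ≤ m → ∀ c ∈ Λb m j, ‖logCovIter L U₀ (iEta η A') j c.1 c.2‖ < 2 * d * L * α₁)
    (H59 : ∀ m, 1 ≤ m → m ≤ k → ∀ (u : Site d → 𝔸ˣ) (W : Site d → Fin d → 𝔸ˣ) (A' : Site d → Fin d → 𝔸),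
      (∀ x, u x ∈ unitaryUnits 𝔸) → mgauge U₀ u W = U' → Restr129 L m (Λs m) U₀ u → IsLandau138W L m η (Ω 0) (Λs m) U₀ W →
      (∀ y τ, IsSelfAdjoint (A' y τ)) →
      (∀ j, j ≤ m → ∀ y τ, SideTouches (Ω j) y τ →
        W y τ = cfgExp η A' y τ ∧ ‖A' y τ‖ ≤ (2 * (L * cstar) + 8 * α₄) * ((L : ℝ) ^ j * η)⁻¹) →
      (∀ y τ, (∀ j, j ≤ m → ¬ SideTouches (Ω j) y τ) → A' y τ = 0) →
      msup L m η (-(1 : ℝ)) (fun j (b : Site d × Fin d) => SideTouches (Ω j) b.1 b.2) (fun b => A' b.1 b.2)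
          ≤ B₀ * (bondNorm L m η (-(3 : ℝ)) Ω (fun x μ => Jcur η U₀ A' μ x)
            + wsup 1 (fun p : {p : ℕ × (Site d × Fin d) // p.1 ≤ m ∧ p.2 ∈ Λb m p.1} =>
                linCovIter L U₀ (iEta η A') p.1.1 p.1.2.1 p.1.2.2)) ∧
        msup L m η (-(2 : ℝ)) (fun j (t : Fin d × Fin d × Site d) => SideTouches (Ω j) t.2.2 t.2.1)
            (fun t => covDerivFwd η U₀ t.1 (fun z => A' z t.2.1) t.2.2)
          ≤ B₀ * (bondNorm L m η (-(3 : ℝ)) Ω (fun x μ => Jcur η U₀ A' μ x)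
            + wsup 1 (fun p : {p : ℕ × (Site d × Fin d) // p.1 ≤ m ∧ p.2 ∈ Λb m p.1} =>
                linCovIter L U₀ (iEta η A') p.1.1 p.1.2.1 p.1.2.2))) :
    ∀ m, m ≤ k → ∃ u : Site d → 𝔸ˣ, (∀ x, u x ∈ unitaryUnits 𝔸) ∧ Restr129 L m (Λs m) U₀ u ∧
      ∃ W : Site d → Fin d → 𝔸ˣ, mgauge U₀ u W = U' ∧ (1 ≤ m → IsLandau138W L m η (Ω 0) (Λs m) U₀ W) ∧
        ∃ A : Site d → Fin d → 𝔸, ∀ j, j ≤ m → ∀ b ∈ {b : Site d × Fin d | SideTouches (Ω j) b.1 b.2},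
          W b.1 b.2 = cfgExp η A b.1 b.2 ∧ IsSelfAdjoint (A b.1 b.2) ∧ ‖A b.1 b.2‖ ≤ cstar * ((L : ℝ) ^ j * η)⁻¹ :=
  thm4_exists_all_levels_of_b9 hd2 hη hL k hU₀ hU' hα₀ hα₁ hα₄ hB₀ hc hs₁ hs₂ ha ha2 hα3 hα4 h16 hd5 hsmall hc₃ hside h50 hC₂ h61
    Ω hΩ Λs Λb hbox h33 h34 h66 (fun m W => IsLandau138W L m η (Ω 0) (Λs m) U₀ W) hP5base hP5 H42 H59

/-- **THE SAME AT THE TOP LEVEL `k`, IN THE LEAF'S SHAPE** «∃ u restricted, the configuration `U₁ = U′^{u⁻¹}` is in the Landau gauge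
(1.38) and of the form `e^{iηA}` with (1.62)» — the `∃ W, W^{u} = U′ ∧ …` of the driver resolved as `W = U′^{u⁻¹} := mgauge U₀ u⁻¹ U′`
(`B8Prop3GaugeFixedKLevel.eq_mgauge_inv_of_mgauge_eq`), the exponent `A = (iη)⁻¹ log U₁ = logCfg η U₁` read back on the bonds by
`logField_spec` (`16c⋆ ≤ 1` from `h16`).  This is the existence clause of `B8.Thm4Body` at a `GFData` member whose `Restricted`,
`Landau`, `C162` fields are `Restr129 L k (Λs k) U₀`, `IsLandau138W L k η (Ω 0) (Λs k) U₀`, «`logCfg` bounded by `B(α₀+α₁)(Lʲη)⁻¹` on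
the bonds of `Ω_j`», modulo the same sockets ((1.37) `C137` is the (1.42) clause `H42` read at `m = k`, left to the Thm-2 cut).
[cite: Balaban1985RegularSpaces, Thm 4 p.88, (1.36)–(1.38) p.82, (1.62) p.87] -/
theorem thm4_exists_leafShape_landau138 (hd2 : 2 ≤ d) {η : ℝ} (hη : 0 < η) {L : ℕ} (hL : 2 ≤ L) (k : ℕ)
    {U₀ U' : Site d → Fin d → 𝔸ˣ} (hU₀ : ∀ x κ, U₀ x κ ∈ unitaryUnits 𝔸) (hU' : ∀ x κ, U' x κ ∈ unitaryUnits 𝔸)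
    {α₀ α₁ α₄ B₀ cstar a : ℝ} (hα₀ : 0 < α₀) (hα₁ : 0 ≤ α₁) (hα₄ : 0 ≤ α₄) (hB₀ : 0 ≤ B₀)
    (hc : cstar = 5 * d * L * B₀ * (α₀ + α₁))
    (hs₁ : α₄ ≤ 1 / 84) (hs₂ : L * cstar ≤ 1 / 12) (ha : a ≤ 1 / 4) (ha2 : 2 * a ≤ cstar)
    (hα3 : C0 d * α₀ ≤ 1 / 3) (hα4 : 4 * α₀ ≤ c2' d L)
    (h16 : 16 * (2 * (L * cstar) + 8 * α₄) ≤ 1) (hd5 : 5 * (2 * (L * cstar) + 8 * α₄) * ((d : ℝ) - 1) ≤ 4)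
    (hsmall : Real.exp (4 * (800 * ((d : ℝ) + 1) ^ 2 * ((d : ℝ) + 4)) * α₀)
      * (1 + 8 * (131072 * ((d : ℝ) + 1) ^ 2) * (2 * (L * cstar) + 8 * α₄)) ≤ 2)
    (hc₃ : 2 * (2 * (L * cstar) + 8 * α₄) ≤ c3 d L) (hside : 36 * d * B₀ * (2 * (L * cstar) + 8 * α₄) ≤ 1 / 2)
    (h50 : 50 * d * (2 * (L * cstar) + 8 * α₄) ≤ 1)
    {C₂ : ℝ} (hC₂ : 8 * (131072 * ((d : ℝ) + 1) ^ 2) * Real.exp (4 * (800 * ((d : ℝ) + 1) ^ 2 * ((d : ℝ) + 4)) * α₀) ≤ C₂)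
    (h61 : 2 * (2 * (L * cstar) + 8 * α₄) ^ 2 + 20 * d * α₀ * (2 * (L * cstar) + 8 * α₄)
      + 2 * C₂ * (2 * (L * cstar) + 8 * α₄) ^ 2 ≤ α₀ + α₁)
    (Ω : ℕ → Set (Site d)) (hΩ : ∀ j, Ω (j + 1) ⊆ Ω j) (Λs : ℕ → ℕ → Set (Site d)) (Λb : ℕ → ℕ → Set (Site d × Fin d))
    (hbox : ∀ m, m ≤ k → ∀ j, j ≤ m → ∀ c ∈ Λb m j, ∀ x, InBox (loK L j c.1) (bondHiK L j c.1 c.2) x → x ∈ Ω j)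
    (h33 : InAk L k η α₀ Ω U₀) (h34 : InAk L k η α₀ Ω (mulCfg U' U₀))
    (h66 : ∀ b ∈ {b : Site d × Fin d | SideTouches (Ω 0) b.1 b.2}, ‖((U' b.1 b.2 : 𝔸ˣ) : 𝔸) - 1‖ ≤ a)
    (hP5base : ∃ (v : Site d → 𝔸ˣ) (lam : Site d → 𝔸), (∀ x, v x ∈ unitaryUnits 𝔸) ∧
        (∀ j, j ≤ 1 → ∀ b ∈ {b : Site d × Fin d | SideTouches (Ω j) b.1 b.2}, (v b.1 : 𝔸) = ((gaugeExp lam b.1 : 𝔸ˣ) : 𝔸) ∧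
          (v (b.1 + e b.2) : 𝔸) = ((gaugeExp lam (b.1 + e b.2) : 𝔸ˣ) : 𝔸)) ∧
        (∀ j, j ≤ 1 → ∀ b ∈ {b : Site d × Fin d | SideTouches (Ω j) b.1 b.2},
          ‖lam b.1‖ ≤ α₄ ∧ ((L : ℝ) ^ j * η) * ‖covDerivFwd η U₀ b.2 lam b.1‖ ≤ α₄) ∧
        IsLandau138W L 1 η (Ω 0) (Λs 1) U₀ (mgauge U₀ v⁻¹ U') ∧ Restr129 L 1 (Λs 1) U₀ ((1 : Site d → 𝔸ˣ) * v))
    (hP5 : ∀ m, 1 ≤ m → m < k → ∀ (u₁ : Site d → 𝔸ˣ) (U₁ : Site d → Fin d → 𝔸ˣ) (A : Site d → Fin d → 𝔸),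
      (∀ x, u₁ x ∈ unitaryUnits 𝔸) → mgauge U₀ u₁ U₁ = U' → Restr129 L m (Λs m) U₀ u₁ → IsLandau138W L m η (Ω 0) (Λs m) U₀ U₁ →
      (∀ j, j ≤ m → ∀ b ∈ {b : Site d × Fin d | SideTouches (Ω j) b.1 b.2},
        U₁ b.1 b.2 = cfgExp η A b.1 b.2 ∧ IsSelfAdjoint (A b.1 b.2) ∧ ‖A b.1 b.2‖ ≤ cstar * ((L : ℝ) ^ j * η)⁻¹) →
      ∃ (v : Site d → 𝔸ˣ) (lam : Site d → 𝔸), (∀ x, v x ∈ unitaryUnits 𝔸) ∧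
        (∀ j, j ≤ m + 1 → ∀ b ∈ {b : Site d × Fin d | SideTouches (Ω j) b.1 b.2}, (v b.1 : 𝔸) = ((gaugeExp lam b.1 : 𝔸ˣ) : 𝔸) ∧
          (v (b.1 + e b.2) : 𝔸) = ((gaugeExp lam (b.1 + e b.2) : 𝔸ˣ) : 𝔸)) ∧
        (∀ j, j ≤ m + 1 → ∀ b ∈ {b : Site d × Fin d | SideTouches (Ω j) b.1 b.2},
          ‖lam b.1‖ ≤ α₄ ∧ ((L : ℝ) ^ j * η) * ‖covDerivFwd η U₀ b.2 lam b.1‖ ≤ α₄) ∧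
        IsLandau138W L (m + 1) η (Ω 0) (Λs (m + 1)) U₀ (mgauge U₀ v⁻¹ U₁) ∧ Restr129 L (m + 1) (Λs (m + 1)) U₀ (u₁ * v))
    (H42 : ∀ m, 1 ≤ m → m ≤ k → ∀ (u : Site d → 𝔸ˣ) (W : Site d → Fin d → 𝔸ˣ) (A' : Site d → Fin d → 𝔸),
      (∀ x, u x ∈ unitaryUnits 𝔸) → mgauge U₀ u W = U' → Restr129 L m (Λs m) U₀ u → IsLandau138W L m η (Ω 0) (Λs m) U₀ W →
      (∀ y τ, IsSelfAdjoint (A' y τ)) →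
      (∀ j, j ≤ m → ∀ y τ, SideTouches (Ω j) y τ →
        W y τ = cfgExp η A' y τ ∧ ‖A' y τ‖ ≤ (2 * (L * cstar) + 8 * α₄) * ((L : ℝ) ^ j * η)⁻¹) →
      (∀ y τ, (∀ j, j ≤ m → ¬ SideTouches (Ω j) y τ) → A' y τ = 0) →
      ∀ j, j ≤ m → ∀ c ∈ Λb m j, ‖logCovIter L U₀ (iEta η A') j c.1 c.2‖ < 2 * d * L * α₁)
    (H59 : ∀ m, 1 ≤ m → m ≤ k → ∀ (u : Site d → 𝔸ˣ) (W : Site d → Fin d → 𝔸ˣ) (A' : Site d → Fin d → 𝔸),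
      (∀ x, u x ∈ unitaryUnits 𝔸) → mgauge U₀ u W = U' → Restr129 L m (Λs m) U₀ u → IsLandau138W L m η (Ω 0) (Λs m) U₀ W →
      (∀ y τ, IsSelfAdjoint (A' y τ)) →
      (∀ j, j ≤ m → ∀ y τ, SideTouches (Ω j) y τ →
        W y τ = cfgExp η A' y τ ∧ ‖A' y τ‖ ≤ (2 * (L * cstar) + 8 * α₄) * ((L : ℝ) ^ j * η)⁻¹) →
      (∀ y τ, (∀ j, j ≤ m → ¬ SideTouches (Ω j) y τ) → A' y τ = 0) →
      msup L m η (-(1 : ℝ)) (fun j (b : Site d × Fin d) => SideTouches (Ω j) b.1 b.2) (fun b => A' b.1 b.2)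
          ≤ B₀ * (bondNorm L m η (-(3 : ℝ)) Ω (fun x μ => Jcur η U₀ A' μ x)
            + wsup 1 (fun p : {p : ℕ × (Site d × Fin d) // p.1 ≤ m ∧ p.2 ∈ Λb m p.1} =>
                linCovIter L U₀ (iEta η A') p.1.1 p.1.2.1 p.1.2.2)) ∧
        msup L m η (-(2 : ℝ)) (fun j (t : Fin d × Fin d × Site d) => SideTouches (Ω j) t.2.2 t.2.1)
            (fun t => covDerivFwd η U₀ t.1 (fun z => A' z t.2.1) t.2.2)
          ≤ B₀ * (bondNorm L m η (-(3 : ℝ)) Ω (fun x μ => Jcur η U₀ A' μ x)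
            + wsup 1 (fun p : {p : ℕ × (Site d × Fin d) // p.1 ≤ m ∧ p.2 ∈ Λb m p.1} =>
                linCovIter L U₀ (iEta η A') p.1.1 p.1.2.1 p.1.2.2))) :
    ∃ u : Site d → 𝔸ˣ, (∀ x, u x ∈ unitaryUnits 𝔸) ∧ Restr129 L k (Λs k) U₀ u ∧
      (1 ≤ k → IsLandau138W L k η (Ω 0) (Λs k) U₀ (mgauge U₀ u⁻¹ U')) ∧
      ∀ j, j ≤ k → ∀ b ∈ {b : Site d × Fin d | SideTouches (Ω j) b.1 b.2},
        mgauge U₀ u⁻¹ U' b.1 b.2 = cfgExp η (logCfg η (mgauge U₀ u⁻¹ U')) b.1 b.2 ∧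
          IsSelfAdjoint (logCfg η (mgauge U₀ u⁻¹ U') b.1 b.2) ∧
          ‖logCfg η (mgauge U₀ u⁻¹ U') b.1 b.2‖ ≤ cstar * ((L : ℝ) ^ j * η)⁻¹ := by
  obtain ⟨u, hu, h129, W, hW, hLan, A, hA⟩ := thm4_exists_all_levels_landau138 hd2 hη hL k hU₀ hU' hα₀ hα₁ hα₄ hB₀ hc hs₁ hs₂ ha
    ha2 hα3 hα4 h16 hd5 hsmall hc₃ hside h50 hC₂ h61 Ω hΩ Λs Λb hbox h33 h34 h66 hP5base hP5 H42 H59 k le_rfl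
  have hWeq : W = mgauge U₀ u⁻¹ U' := eq_mgauge_inv_of_mgauge_eq hW
  have hWu : ∀ x κ, W x κ ∈ unitaryUnits 𝔸 := mem_unitaryUnits_of_mgauge_eq hU₀ hU' hu hW
  have hL1 : (1 : ℝ) ≤ L := by exact_mod_cast le_trans (by norm_num) hL
  have hcstar : 0 ≤ cstar := by rw [hc]; positivity
  -- `c⋆ ≤ 2Lc⋆ + 8α₄ ≤ 1/16`
  have hc16 : cstar ≤ 1 / 16 := by nlinarith
  refine ⟨u, hu, h129, fun hk => hWeq ▸ hLan hk, fun j hj b hb => ?_⟩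
  obtain ⟨hexp, -, hbd⟩ := hA j hj b hb
  -- `‖A_b‖ ≤ c⋆(Lʲη)⁻¹ ≤ c⋆ η⁻¹`
  have hbd' : ‖A b.1 b.2‖ ≤ cstar * η⁻¹ := by
    refine hbd.trans ?_
    have hLj : (1 : ℝ) ≤ (L : ℝ) ^ j := one_le_pow₀ hL1
    have : ((L : ℝ) ^ j * η)⁻¹ ≤ η⁻¹ := by
      rw [mul_inv]
      calc ((L : ℝ) ^ j)⁻¹ * η⁻¹ ≤ 1 * η⁻¹ := by gcongr; exact inv_le_one_of_one_le₀ hLj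
        _ = η⁻¹ := one_mul _
    exact mul_le_mul_of_nonneg_left this hcstar
  obtain ⟨hlogA, hsa, hWexp⟩ := logField_spec hη U₀ hWu hexp hbd' hc16
  rw [← hWeq]
  refine ⟨hWexp, ?_, ?_⟩
  · simpa [logCfg] using hsa
  · show ‖logCfg η W b.1 b.2‖ ≤ _
    rw [logCfg, hlogA]
    exact hbd

end Main

/-! ## The uniqueness clause at the same instance -/

section Unique

variable {𝔸 : Type*} [CStarAlgebra 𝔸] [Nontrivial 𝔸]
variable {L k : ℕ} {η : ℝ} {Λ : ℕ → Set (Site d)} {U₀ U' U₁ U₂ : Site d → Fin d → 𝔸ˣ} {α₀ αP c : ℝ}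
  {u₁ u₂ : Site d → 𝔸ˣ} {A₁ A₂ : Site d → Fin d → 𝔸}

/-- **THEOREM 4, UNIQUENESS CLAUSE ON THE CONCRETE CARRIERS, LANDAU EQUATION INSTANTIATED** — `B8Thm4UniqueLocal.thm4_unique_of_agree`
(two restricted gauge transformations `u₁`, `u₂` putting `U′` into the form `U_i = e^{iηA_i}` with (1.62) on the towers and (1.38), agree on
every tower `Bʲ(y)`, `y ∈ Λ_j`, `j ≤ k`, MODULO Proposition 5's uniqueness clause `hP5u` for the datum `(U₀, U₁, u₁)`) at
`Lan := IsLandau138W L k η Ω₀ Λ U₀` (Dirichlet domain `Ω₀`, `k` levels, constraint sets `Λ`).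
[cite: Balaban1985RegularSpaces, Thm 4 p.88, proof p.95 (1.112), (1.38) p.82, Prop. 5 (1.109) p.94] -/
theorem thm4_unique_of_agree_landau138 (Ω₀ : Set (Site d)) (hd : 1 ≤ d) (hL : 2 ≤ L) (hL1 : 1 ≤ L) (hη : 0 < η)
    (hU₀ : ∀ x κ, U₀ x κ ∈ unitaryUnits 𝔸) (hU' : ∀ x κ, U' x κ ∈ unitaryUnits 𝔸)
    (hu₁ : ∀ x, u₁ x ∈ unitaryUnits 𝔸) (hu₂ : ∀ x, u₂ x ∈ unitaryUnits 𝔸)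
    (hα : 0 < α₀) (hα3 : C0 d * α₀ ≤ 1 / 3) (hα4 : 4 * α₀ ≤ c2' d L) (hc : 0 ≤ c)
    (hsmall : Real.exp (4 * (800 * ((d : ℝ) + 1) ^ 2 * ((d : ℝ) + 4)) * α₀) * (1 + 8 * (131072 * ((d : ℝ) + 1) ^ 2) * c) ≤ 2)
    (hc₃ : 2 * c ≤ c3 d L) (hsm : 2048 * (d : ℝ) * c ≤ 1) (hα₃ : 40 * d * c ≤ 1 / 5000)
    (hαP : 0 < αP) (hαP3 : C0 d * αP ≤ 1 / 3) (hαP2 : 2 * αP ≤ c2' d L)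
    {cu : ℝ} (hcu₁ : 2 * (2 * (40 * d * c) + 2 * 1116 * (40 * d * c) ^ 2) < cu) (hcu₂ : 5 * c < cu)
    (h33 : ∀ j, j ≤ k → ∀ y ∈ Λ j, pdevOn (tlo L y j) (thi L y j) U₀ < α₀ * (((L : ℝ) ^ j)⁻¹) ^ 2)
    (h34 : ∀ j, j ≤ k → ∀ y ∈ Λ j, pdevOn (tlo L y j) (thi L y j) (U' * U₀) < αP * (((L : ℝ) ^ j)⁻¹) ^ 2)
    (hAx : InAx L k Λ U₀ (U' * U₀)) (h129₁ : Restr129 L k Λ U₀ u₁) (h129₂ : Restr129 L k Λ U₀ u₂)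
    (h₁ : mgauge U₀ u₁ U₁ = U') (h₂ : mgauge U₀ u₂ U₂ = U')
    (hA₁ : ∀ j, j ≤ k → ∀ y ∈ Λ j, AgreeOn (tlo L y j) (thi L y j) U₁ (cfgExp η A₁))
    (hA₂ : ∀ j, j ≤ k → ∀ y ∈ Λ j, AgreeOn (tlo L y j) (thi L y j) U₂ (cfgExp η A₂))
    (h62₁ : ∀ j, j ≤ k → ∀ y ∈ Λ j, ∀ (x : Site d) (κ : Fin d), InBox (tlo L y j) (thi L y j) x →
      InBox (tlo L y j) (thi L y j) (x + e κ) → ‖A₁ x κ‖ ≤ c * ((L : ℝ) ^ j * η)⁻¹)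
    (h62₂ : ∀ j, j ≤ k → ∀ y ∈ Λ j, ∀ (x : Site d) (κ : Fin d), InBox (tlo L y j) (thi L y j) x →
      InBox (tlo L y j) (thi L y j) (x + e κ) → ‖A₂ x κ‖ ≤ c * ((L : ℝ) ^ j * η)⁻¹)
    (hLan₁ : IsLandau138W L k η Ω₀ Λ U₀ U₁) (hLan₂ : IsLandau138W L k η Ω₀ Λ U₀ U₂)
    (hP5u : ∀ (v w : Site d → 𝔸ˣ) (lam mu : Site d → 𝔸),
      (∀ j, j ≤ k → ∀ y ∈ Λ j, ∀ x : Site d, InBox (tlo L y j) (thi L y j) x →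
        ((gaugeExp lam x : 𝔸ˣ) : 𝔸) = ((v x : 𝔸ˣ) : 𝔸) ∧ IsSelfAdjoint (lam x) ∧ ‖lam x‖ < cu ∧
          ∀ κ : Fin d, InBox (tlo L y j) (thi L y j) (x + e κ) → ((L : ℝ) ^ j * η) * ‖covDerivFwd η U₀ κ lam x‖ < cu) →
      (∀ j, j ≤ k → ∀ y ∈ Λ j, ∀ x : Site d, InBox (tlo L y j) (thi L y j) x →
        ((gaugeExp mu x : 𝔸ˣ) : 𝔸) = ((w x : 𝔸ˣ) : 𝔸) ∧ IsSelfAdjoint (mu x) ∧ ‖mu x‖ < cu ∧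
          ∀ κ : Fin d, InBox (tlo L y j) (thi L y j) (x + e κ) → ((L : ℝ) ^ j * η) * ‖covDerivFwd η U₀ κ mu x‖ < cu) →
      IsLandau138W L k η Ω₀ Λ U₀ (mgauge U₀ v⁻¹ U₁) → Restr129 L k Λ U₀ (u₁ * v) →
      IsLandau138W L k η Ω₀ Λ U₀ (mgauge U₀ w⁻¹ U₁) → Restr129 L k Λ U₀ (u₁ * w) →
      ∀ j, j ≤ k → ∀ y ∈ Λ j, ∀ x : Site d, InBox (tlo L y j) (thi L y j) x → v x = w x) :
    ∀ j, j ≤ k → ∀ y ∈ Λ j, ∀ x : Site d, InBox (tlo L y j) (thi L y j) x → u₁ x = u₂ x :=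
  thm4_unique_of_agree hd hL hL1 hη hU₀ hU' hu₁ hu₂ hα hα3 hα4 hc hsmall hc₃ hsm hα₃ hαP hαP3 hαP2 hcu₁ hcu₂ h33 h34 hAx h129₁ h129₂
    h₁ h₂ hA₁ hA₂ h62₁ h62₂ (IsLandau138W L k η Ω₀ Λ U₀) hLan₁ hLan₂ hP5u

end Unique

/-! ## v2 (append-only, 2026-08-26): the instance over `B8Thm4ExistsModB9` — (1.42) discharged -/

section ModB9

variable {𝔸 : Type*} [CStarAlgebra 𝔸] [Nontrivial 𝔸]

open B8Thm2LogB (blockTop)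
open B8Thm4ExistsModB9 (thm4_exists_all_levels_modB9)

/-- **THEOREM 4, EXISTENCE CLAUSE AT ALL LEVELS, LANDAU EQUATION INSTANTIATED, (1.42) CLAUSE DISCHARGED** — `pub-ymgap-dag-n04-b`'s
`B8Thm4ExistsModB9.thm4_exists_all_levels_modB9` (p420135: `thm4_exists_all_levels_of_b9` with `H42 := B8Eq142KLevelLocal.H42_of_inAx`, the
(1.42) clause derived from (1.34)-axial `hAx`, (1.35) `h135`, the constraint-bond classes `hclass` and `dLα₁ ≤ 1/8`) at
`Lan m W := IsLandau138W L m η (Ω 0) (Λs m) U₀ W`.  Remaining hypotheses: Proposition 5 (`hP5base`, `hP5`), [4] Theorem 3.3 per gauge-fixed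
field (`H59`, in-edge b9), the standing (1.33)/(1.34)/(1.34)-axial/(1.35)/(1.66)₀, the family-of-record data `hbox`/`hclass`, and the
explicit windows (`B8Thm4Windows.thm4_windows` + `dLα₁ ≤ 1/8`). (v2, append-only.)
[cite: Balaban1985RegularSpaces, Thm 4 p.88, (1.38) p.82, (1.42) p.83, Prop. 5 p.94, pp.94–95] -/
theorem thm4_exists_all_levels_landau138_modB9 (hd2 : 2 ≤ d) {η : ℝ} (hη : 0 < η) {L : ℕ} (hL : 2 ≤ L) (k : ℕ)
    {U₀ U' : Site d → Fin d → 𝔸ˣ} (hU₀ : ∀ x κ, U₀ x κ ∈ unitaryUnits 𝔸) (hU' : ∀ x κ, U' x κ ∈ unitaryUnits 𝔸)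
    {α₀ α₁ α₄ B₀ cstar a : ℝ} (hα₀ : 0 < α₀) (hα₁ : 0 < α₁) (hα₄ : 0 ≤ α₄) (hB₀ : 0 ≤ B₀)
    (hc : cstar = 5 * d * L * B₀ * (α₀ + α₁))
    (hs₁ : α₄ ≤ 1 / 84) (hs₂ : L * cstar ≤ 1 / 12) (ha : a ≤ 1 / 4) (ha2 : 2 * a ≤ cstar)
    (hα3 : C0 d * α₀ ≤ 1 / 3) (hα4 : 4 * α₀ ≤ c2' d L)
    (h16 : 16 * (2 * (L * cstar) + 8 * α₄) ≤ 1) (hd5 : 5 * (2 * (L * cstar) + 8 * α₄) * ((d : ℝ) - 1) ≤ 4)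
    (hsmall : Real.exp (4 * (800 * ((d : ℝ) + 1) ^ 2 * ((d : ℝ) + 4)) * α₀)
      * (1 + 8 * (131072 * ((d : ℝ) + 1) ^ 2) * (2 * (L * cstar) + 8 * α₄)) ≤ 2)
    (hc₃ : 2 * (2 * (L * cstar) + 8 * α₄) ≤ c3 d L) (hside : 36 * d * B₀ * (2 * (L * cstar) + 8 * α₄) ≤ 1 / 2)
    (h50 : 50 * d * (2 * (L * cstar) + 8 * α₄) ≤ 1) (hsmall₁ : (d : ℝ) * L * α₁ ≤ 1 / 8)
    {C₂ : ℝ} (hC₂ : 8 * (131072 * ((d : ℝ) + 1) ^ 2) * Real.exp (4 * (800 * ((d : ℝ) + 1) ^ 2 * ((d : ℝ) + 4)) * α₀) ≤ C₂)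
    (h61 : 2 * (2 * (L * cstar) + 8 * α₄) ^ 2 + 20 * d * α₀ * (2 * (L * cstar) + 8 * α₄)
      + 2 * C₂ * (2 * (L * cstar) + 8 * α₄) ^ 2 ≤ α₀ + α₁)
    (Ω : ℕ → Set (Site d)) (hΩ : ∀ j, Ω (j + 1) ⊆ Ω j) (Λs : ℕ → ℕ → Set (Site d)) (Λb : ℕ → ℕ → Set (Site d × Fin d))
    (hbox : ∀ m, m ≤ k → ∀ j, j ≤ m → ∀ c ∈ Λb m j, ∀ x, InBox (loK L j c.1) (bondHiK L j c.1 c.2) x → x ∈ Ω j)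
    (hclass : ∀ m, m ≤ k → ∀ j, j ≤ m → ∀ c ∈ Λb m j,
      (c.1 ∈ Λs m j ∧ c.1 + e c.2 ∈ Λs m j) ∨
      (∃ j', j = j' + 1 ∧ (∀ x, (L : ℤ) • c.1 ≤ x → x ≤ (L : ℤ) • c.1 + blockTop L → x ∈ Λs m j') ∧ c.1 + e c.2 ∈ Λs m j) ∨
      (∃ j', j = j' + 1 ∧ c.1 ∈ Λs m j ∧ (∀ x, (L : ℤ) • (c.1 + e c.2) ≤ x → x ≤ (L : ℤ) • (c.1 + e c.2) + blockTop L → x ∈ Λs m j')))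
    (h33 : InAk L k η α₀ Ω U₀) (h34 : InAk L k η α₀ Ω (mulCfg U' U₀))
    (hAx : ∀ m, m ≤ k → InAx L m (Λs m) U₀ (mulCfg U' U₀))
    (h135 : ∀ j, j ≤ k → ∀ (z : Site d) (μ : Fin d), (∀ x, InBox (loK L j z) (bondHiK L j z μ) x → x ∈ Ω j) →
      ‖(avgIter L (mulCfg U' U₀) j z μ : 𝔸) - (avgIter L U₀ j z μ : 𝔸)‖ ≤ α₁)
    (h66 : ∀ b ∈ {b : Site d × Fin d | SideTouches (Ω 0) b.1 b.2}, ‖((U' b.1 b.2 : 𝔸ˣ) : 𝔸) - 1‖ ≤ a)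
    (hP5base : ∃ (v : Site d → 𝔸ˣ) (lam : Site d → 𝔸), (∀ x, v x ∈ unitaryUnits 𝔸) ∧
        (∀ j, j ≤ 1 → ∀ b ∈ {b : Site d × Fin d | SideTouches (Ω j) b.1 b.2}, (v b.1 : 𝔸) = ((gaugeExp lam b.1 : 𝔸ˣ) : 𝔸) ∧
          (v (b.1 + e b.2) : 𝔸) = ((gaugeExp lam (b.1 + e b.2) : 𝔸ˣ) : 𝔸)) ∧
        (∀ j, j ≤ 1 → ∀ b ∈ {b : Site d × Fin d | SideTouches (Ω j) b.1 b.2},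
          ‖lam b.1‖ ≤ α₄ ∧ ((L : ℝ) ^ j * η) * ‖covDerivFwd η U₀ b.2 lam b.1‖ ≤ α₄) ∧
        IsLandau138W L 1 η (Ω 0) (Λs 1) U₀ (mgauge U₀ v⁻¹ U') ∧ Restr129 L 1 (Λs 1) U₀ ((1 : Site d → 𝔸ˣ) * v))
    (hP5 : ∀ m, 1 ≤ m → m < k → ∀ (u₁ : Site d → 𝔸ˣ) (U₁ : Site d → Fin d → 𝔸ˣ) (A : Site d → Fin d → 𝔸),
      (∀ x, u₁ x ∈ unitaryUnits 𝔸) → mgauge U₀ u₁ U₁ = U' → Restr129 L m (Λs m) U₀ u₁ → IsLandau138W L m η (Ω 0) (Λs m) U₀ U₁ →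
      (∀ j, j ≤ m → ∀ b ∈ {b : Site d × Fin d | SideTouches (Ω j) b.1 b.2},
        U₁ b.1 b.2 = cfgExp η A b.1 b.2 ∧ IsSelfAdjoint (A b.1 b.2) ∧ ‖A b.1 b.2‖ ≤ cstar * ((L : ℝ) ^ j * η)⁻¹) →
      ∃ (v : Site d → 𝔸ˣ) (lam : Site d → 𝔸), (∀ x, v x ∈ unitaryUnits 𝔸) ∧
        (∀ j, j ≤ m + 1 → ∀ b ∈ {b : Site d × Fin d | SideTouches (Ω j) b.1 b.2}, (v b.1 : 𝔸) = ((gaugeExp lam b.1 : 𝔸ˣ) : 𝔸) ∧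
          (v (b.1 + e b.2) : 𝔸) = ((gaugeExp lam (b.1 + e b.2) : 𝔸ˣ) : 𝔸)) ∧
        (∀ j, j ≤ m + 1 → ∀ b ∈ {b : Site d × Fin d | SideTouches (Ω j) b.1 b.2},
          ‖lam b.1‖ ≤ α₄ ∧ ((L : ℝ) ^ j * η) * ‖covDerivFwd η U₀ b.2 lam b.1‖ ≤ α₄) ∧
        IsLandau138W L (m + 1) η (Ω 0) (Λs (m + 1)) U₀ (mgauge U₀ v⁻¹ U₁) ∧ Restr129 L (m + 1) (Λs (m + 1)) U₀ (u₁ * v))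
    (H59 : ∀ m, 1 ≤ m → m ≤ k → ∀ (u : Site d → 𝔸ˣ) (W : Site d → Fin d → 𝔸ˣ) (A' : Site d → Fin d → 𝔸),
      (∀ x, u x ∈ unitaryUnits 𝔸) → mgauge U₀ u W = U' → Restr129 L m (Λs m) U₀ u → IsLandau138W L m η (Ω 0) (Λs m) U₀ W →
      (∀ y τ, IsSelfAdjoint (A' y τ)) →
      (∀ j, j ≤ m → ∀ y τ, SideTouches (Ω j) y τ →
        W y τ = cfgExp η A' y τ ∧ ‖A' y τ‖ ≤ (2 * (L * cstar) + 8 * α₄) * ((L : ℝ) ^ j * η)⁻¹) →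
      (∀ y τ, (∀ j, j ≤ m → ¬ SideTouches (Ω j) y τ) → A' y τ = 0) →
      msup L m η (-(1 : ℝ)) (fun j (b : Site d × Fin d) => SideTouches (Ω j) b.1 b.2) (fun b => A' b.1 b.2)
          ≤ B₀ * (bondNorm L m η (-(3 : ℝ)) Ω (fun x μ => Jcur η U₀ A' μ x)
            + wsup 1 (fun p : {p : ℕ × (Site d × Fin d) // p.1 ≤ m ∧ p.2 ∈ Λb m p.1} =>
                linCovIter L U₀ (iEta η A') p.1.1 p.1.2.1 p.1.2.2)) ∧
        msup L m η (-(2 : ℝ)) (fun j (t : Fin d × Fin d × Site d) => SideTouches (Ω j) t.2.2 t.2.1)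
            (fun t => covDerivFwd η U₀ t.1 (fun z => A' z t.2.1) t.2.2)
          ≤ B₀ * (bondNorm L m η (-(3 : ℝ)) Ω (fun x μ => Jcur η U₀ A' μ x)
            + wsup 1 (fun p : {p : ℕ × (Site d × Fin d) // p.1 ≤ m ∧ p.2 ∈ Λb m p.1} =>
                linCovIter L U₀ (iEta η A') p.1.1 p.1.2.1 p.1.2.2))) :
    ∀ m, m ≤ k → ∃ u : Site d → 𝔸ˣ, (∀ x, u x ∈ unitaryUnits 𝔸) ∧ Restr129 L m (Λs m) U₀ u ∧
      ∃ W : Site d → Fin d → 𝔸ˣ, mgauge U₀ u W = U' ∧ (1 ≤ m → IsLandau138W L m η (Ω 0) (Λs m) U₀ W) ∧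
        ∃ A : Site d → Fin d → 𝔸, ∀ j, j ≤ m → ∀ b ∈ {b : Site d × Fin d | SideTouches (Ω j) b.1 b.2},
          W b.1 b.2 = cfgExp η A b.1 b.2 ∧ IsSelfAdjoint (A b.1 b.2) ∧ ‖A b.1 b.2‖ ≤ cstar * ((L : ℝ) ^ j * η)⁻¹ :=
  thm4_exists_all_levels_modB9 hd2 hη hL k hU₀ hU' hα₀ hα₁ hα₄ hB₀ hc hs₁ hs₂ ha ha2 hα3 hα4 h16 hd5 hsmall hc₃ hside h50 hsmall₁
    hC₂ h61 Ω hΩ Λs Λb hbox hclass h33 h34 hAx h135 h66 (fun m W => IsLandau138W L m η (Ω 0) (Λs m) U₀ W) hP5base hP5 H59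

end ModB9

/-! ## v3 (append-only, 2026-08-26): the uniqueness clause in the LEAF'S SHAPE -/

section UniqueLeaf

variable {𝔸 : Type*} [CStarAlgebra 𝔸] [Nontrivial 𝔸]
variable {L k : ℕ} {η : ℝ} {Ω : ℕ → Set (Site d)} {Λ : ℕ → Set (Site d)} {U₀ U' : Site d → Fin d → 𝔸ˣ} {α₀ αP c : ℝ}
  {u₁ u₂ : Site d → 𝔸ˣ}

omit [Nontrivial 𝔸] in
/-- **(1.7) at level `j` on a tower `Bʲ(y) ⊂ Ω_j`** from `U ∈ 𝔄_k({Ω_j}, α)` (`j ≤ k`): `sup_{p ⊂ Bʲ(y)} |U(∂p) − 1| < αL^{−2j}` — the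
tower-local regularity input `h33`/`h34` of `B8Thm4UniqueLocal` read off the class `InAk` (as `B8Prop6OfThm4.pdevOn_lt_of_inAk_top` at the
top level). [cite: Balaban1985RegularSpaces, (1.7) p.77, (1.33) p.82] -/
theorem pdevOn_tower_lt_of_inAk (hL1 : 1 ≤ L) {α : ℝ} (hα : 0 < α) {U : Site d → Fin d → 𝔸ˣ} (hA : InAk L k η α Ω U)
    {j : ℕ} (hj : j ≤ k) {y : Site d} (hy : ∀ x, InBox (tlo L y j) (thi L y j) x → x ∈ Ω j) :
    pdevOn (tlo L y j) (thi L y j) U < α * (((L : ℝ) ^ j)⁻¹) ^ 2 := by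
  have hL0 : 0 < L := hL1
  refine B8Ineq132.pdevOn_lt_of_forall (by positivity) fun x μ ν hx _ => ?_
  rcases eq_or_ne μ ν with rfl | hμν
  · rw [hol_plaqWord_self, Units.val_one, sub_self, norm_zero]; positivity
  · exact (hA j hj).1 x μ ν hμν (Or.inl (hy x hx))

omit [Nontrivial 𝔸] in
/-- `U′ = (U′^{u⁻¹})^{u}`: the moving-frame action (55) is a group action. [cite: Balaban1985Averaging, (55)–(57) p.27] -/
theorem mgauge_mgauge_inv (U₀ U' : Site d → Fin d → 𝔸ˣ) (u : Site d → 𝔸ˣ) : mgauge U₀ u (mgauge U₀ u⁻¹ U') = U' := by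
  rw [B7Eq106Concrete.mgauge_mgauge, mul_inv_cancel]
  funext x κ
  simp [mgauge_apply]

/-- **THEOREM 4, UNIQUENESS CLAUSE IN THE LEAF'S SHAPE, LANDAU EQUATION INSTANTIATED** — «for arbitrary U₀, U′U₀ satisfying (1.33),
(1.34) … there exists EXACTLY ONE gauge transformation u satisfying (1.29) and such that (1.37), (1.38), (1.62) hold for U₁ = U′^{u⁻¹}»,
read at a `GFData` member whose fields are the concrete predicates: two unitary-valued `u₁`, `u₂` with (1.29) `Restr129 L k Λ U₀ u_i`,
whose `U_i := U′^{u_i⁻¹}` satisfy (1.38) `IsLandau138W L k η Ω₀ Λ U₀ U_i` and the (1.62)-shape «`U_i = e^{iηA_i}` with `‖A_i‖ ≤ c(Lʲη)⁻¹`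
on the bonds of Ω_j» (the leaf's `C162` at the instance, in `SideTouches` currency), AGREE on every constraint tower `Bʲ(y)`, `y ∈ Λ_j`,
`j ≤ k` — MODULO Proposition 5's uniqueness clause `hP5u` for the datum `(U₀, U₁, u₁)` (socket) and GIVEN: `U₀ ∈ 𝔄_k({Ω_j}, α₀)`,
`U′U₀ ∈ 𝔄_k({Ω_j}, α_P)` ((1.33)/(1.34), `InAk`), the block axial gauge (1.34) `InAx L k Λ U₀ (U′U₀)`, the admissibility clause «`Bʲ(y) ⊂
Ω_j` for `y ∈ Λ_j`» (`htower`), `d ≥ 2`, and the explicit windows of `B8Thm4UniqueLocal` ((1.37) is not read by the uniqueness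
mechanism).  From `thm4_unique_of_agree_landau138` + `pdevOn_tower_lt_of_inAk` + `B8Eq140Level.sideTouches_of_bondTouches`.
[cite: Balaban1985RegularSpaces, Thm 4 p.88 («exactly one»), proof p.95 (1.112), (1.62) p.87, (1.38) p.82, Prop. 5 (1.109) p.94] -/
theorem thm4_unique_leafShape_landau138 (hd2 : 2 ≤ d) (hL : 2 ≤ L) (hη : 0 < η)
    (hU₀ : ∀ x κ, U₀ x κ ∈ unitaryUnits 𝔸) (hU' : ∀ x κ, U' x κ ∈ unitaryUnits 𝔸)
    (hu₁ : ∀ x, u₁ x ∈ unitaryUnits 𝔸) (hu₂ : ∀ x, u₂ x ∈ unitaryUnits 𝔸)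
    (hα : 0 < α₀) (hα3 : C0 d * α₀ ≤ 1 / 3) (hα4 : 4 * α₀ ≤ c2' d L) (hc : 0 ≤ c)
    (hsmall : Real.exp (4 * (800 * ((d : ℝ) + 1) ^ 2 * ((d : ℝ) + 4)) * α₀) * (1 + 8 * (131072 * ((d : ℝ) + 1) ^ 2) * c) ≤ 2)
    (hc₃ : 2 * c ≤ c3 d L) (hsm : 2048 * (d : ℝ) * c ≤ 1) (hα₃ : 40 * d * c ≤ 1 / 5000)
    (hαP : 0 < αP) (hαP3 : C0 d * αP ≤ 1 / 3) (hαP2 : 2 * αP ≤ c2' d L)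
    {cu : ℝ} (hcu₁ : 2 * (2 * (40 * d * c) + 2 * 1116 * (40 * d * c) ^ 2) < cu) (hcu₂ : 5 * c < cu)
    (h33 : InAk L k η α₀ Ω U₀) (h34 : InAk L k η αP Ω (U' * U₀)) (hAx : InAx L k Λ U₀ (U' * U₀))
    (htower : ∀ j, j ≤ k → ∀ y ∈ Λ j, ∀ x, InBox (tlo L y j) (thi L y j) x → x ∈ Ω j)
    (h129₁ : Restr129 L k Λ U₀ u₁) (h129₂ : Restr129 L k Λ U₀ u₂)
    (hLan₁ : IsLandau138W L k η (Ω 0) Λ U₀ (mgauge U₀ u₁⁻¹ U')) (hLan₂ : IsLandau138W L k η (Ω 0) Λ U₀ (mgauge U₀ u₂⁻¹ U'))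
    (h162₁ : ∃ A₁ : Site d → Fin d → 𝔸, ∀ j, j ≤ k → ∀ (x : Site d) (κ : Fin d), SideTouches (Ω j) x κ →
      mgauge U₀ u₁⁻¹ U' x κ = cfgExp η A₁ x κ ∧ ‖A₁ x κ‖ ≤ c * ((L : ℝ) ^ j * η)⁻¹)
    (h162₂ : ∃ A₂ : Site d → Fin d → 𝔸, ∀ j, j ≤ k → ∀ (x : Site d) (κ : Fin d), SideTouches (Ω j) x κ →
      mgauge U₀ u₂⁻¹ U' x κ = cfgExp η A₂ x κ ∧ ‖A₂ x κ‖ ≤ c * ((L : ℝ) ^ j * η)⁻¹)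
    (hP5u : ∀ (v w : Site d → 𝔸ˣ) (lam mu : Site d → 𝔸),
      (∀ j, j ≤ k → ∀ y ∈ Λ j, ∀ x : Site d, InBox (tlo L y j) (thi L y j) x →
        ((gaugeExp lam x : 𝔸ˣ) : 𝔸) = ((v x : 𝔸ˣ) : 𝔸) ∧ IsSelfAdjoint (lam x) ∧ ‖lam x‖ < cu ∧
          ∀ κ : Fin d, InBox (tlo L y j) (thi L y j) (x + e κ) → ((L : ℝ) ^ j * η) * ‖covDerivFwd η U₀ κ lam x‖ < cu) →
      (∀ j, j ≤ k → ∀ y ∈ Λ j, ∀ x : Site d, InBox (tlo L y j) (thi L y j) x →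
        ((gaugeExp mu x : 𝔸ˣ) : 𝔸) = ((w x : 𝔸ˣ) : 𝔸) ∧ IsSelfAdjoint (mu x) ∧ ‖mu x‖ < cu ∧
          ∀ κ : Fin d, InBox (tlo L y j) (thi L y j) (x + e κ) → ((L : ℝ) ^ j * η) * ‖covDerivFwd η U₀ κ mu x‖ < cu) →
      IsLandau138W L k η (Ω 0) Λ U₀ (mgauge U₀ v⁻¹ (mgauge U₀ u₁⁻¹ U')) → Restr129 L k Λ U₀ (u₁ * v) →
      IsLandau138W L k η (Ω 0) Λ U₀ (mgauge U₀ w⁻¹ (mgauge U₀ u₁⁻¹ U')) → Restr129 L k Λ U₀ (u₁ * w) →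
      ∀ j, j ≤ k → ∀ y ∈ Λ j, ∀ x : Site d, InBox (tlo L y j) (thi L y j) x → v x = w x) :
    ∀ j, j ≤ k → ∀ y ∈ Λ j, ∀ x : Site d, InBox (tlo L y j) (thi L y j) x → u₁ x = u₂ x := by
  have hL1 : 1 ≤ L := le_trans (by norm_num) hL
  have hd : 1 ≤ d := le_trans (by norm_num) hd2
  haveI : Nontrivial (Fin d) := Fin.nontrivial_iff_two_le.mpr hd2
  obtain ⟨A₁, hA₁⟩ := h162₁
  obtain ⟨A₂, hA₂⟩ := h162₂
  -- a bond inside a tower `Bʲ(y) ⊂ Ω_j` is a side of a plaquette touching `Ω_j`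
  have hside : ∀ j, j ≤ k → ∀ y ∈ Λ j, ∀ (x : Site d) (κ : Fin d), InBox (tlo L y j) (thi L y j) x →
      SideTouches (Ω j) x κ := by
    intro j hj y hy x κ hx
    obtain ⟨κ', hκ'⟩ := exists_ne κ
    exact sideTouches_of_bondTouches hκ' (Or.inl (htower j hj y hy x hx))
  exact thm4_unique_of_agree_landau138 (Ω 0) hd hL hL1 hη hU₀ hU' hu₁ hu₂ hα hα3 hα4 hc hsmall hc₃ hsm hα₃ hαP hαP3 hαP2 hcu₁ hcu₂
    (fun j hj y hy => pdevOn_tower_lt_of_inAk hL1 hα h33 hj (htower j hj y hy))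
    (fun j hj y hy => pdevOn_tower_lt_of_inAk hL1 hαP h34 hj (htower j hj y hy))
    hAx h129₁ h129₂ (mgauge_mgauge_inv U₀ U' u₁) (mgauge_mgauge_inv U₀ U' u₂)
    (fun j hj y hy x κ hx _ => (hA₁ j hj x κ (hside j hj y hy x κ hx)).1)
    (fun j hj y hy x κ hx _ => (hA₂ j hj x κ (hside j hj y hy x κ hx)).1)
    (fun j hj y hy x κ hx _ => (hA₁ j hj x κ (hside j hj y hy x κ hx)).2)
    (fun j hj y hy x κ hx _ => (hA₂ j hj x κ (hside j hj y hy x κ hx)).2)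
    hLan₁ hLan₂ hP5u

end UniqueLeaf

#print axioms thm4_exists_all_levels_landau138
#print axioms thm4_exists_all_levels_landau138_modB9
#print axioms thm4_unique_leafShape_landau138

end Literature.MathematicalPhysics.QuantumFieldTheory.Balaban1983to89.B8Thm4AtLandau138

end
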